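import Summits.Ventures.CertifiedArithmetic.LowPrec.ErrorFreeAdd
import Summits.Ventures.CertifiedArithmetic.LowPrec.Exact
import Mathlib.Data.Nat.Log

/-!
# The error of a rounded product is a value of the format — unless the product underflows

HONEST FRAMING (venture CertifiedArithmetic / cell `pub-lowprec`): certified error envelopes and
provably optimal rounding/accumulation schemes for low-precision formats under stated cost models;
every table by two implementations; no hardware or vendor claims.

The multiplicative companion of `ErrorFreeAdd.lean` (the basis of the FMA-based product EFT
`2MultFMA` and of compensated dot products in a working format): for data `a, b` of a format `φ`
with the product delivered IN THE SAME FORMAT by `fl = roundNE φ`, the error `ab - fl(ab)` is a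
value of `φ` provided (i) the product does not reach below the quantum — `ulp(a)·ulp(b) ≥ quantum`,
i.e. the ulp exponents satisfy `(E_a - 1) + (E_b - 1) + qexp ≥ 0` — and (ii) `|ab| ≤ maxRat`
(`mulErr_representable`). The magnitude form `|ab| ≥ 2^(2p-1)·quantum` of (i)
(`mulErr_representable_of_le`) is [BoldoMelquiond2017, Lemma 5.9] (`β^(e_min + 2p - 1)` with
`e_min` the quantum exponent); consequently the FMA step `fl(ab - fl(ab))` returns the error exactly
(`twoMultFMA_exact`). Both side conditions are needed: in `E2M1`, `½ · ½ = ¼` rounds to `0` with the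
non-representable error `¼` (underflow), and `4 · 4 = 16` saturates to `6` with error `10 ∉ F`
(`mulErr_not_representable_examples`). Integer proof as in `ErrorFreeAdd.lean`: with
`2^d = ulp(a)ulp(b)/quantum`, the product, the rounded product (`pow_dvd_toInt_roundNE_of_le`) and
hence the error are multiples of `2^d`, and the error is below half an ulp of the product's binade.
-/

namespace Literature.ComputerArithmetic.FloatingPoint

namespace MiniFloat

open Format

variable {φ : Format}

/-- Variant of `pow_dvd_toInt_roundNE` without the divisibility of `maxScaled`, for in-range
arguments: if `2^g ∣ N` and `|N| ≤ maxScaled` then `2^g` divides the signed magnitude of `fl(N·q)`.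
[folklore] -/
theorem pow_dvd_toInt_roundNE_of_le {g : ℕ} {N : ℤ} (hN : ((2 ^ g : ℕ) : ℤ) ∣ N)
    (hle : N.natAbs ≤ φ.maxScaled) : ((2 ^ g : ℕ) : ℤ) ∣ (roundNE φ ((N : ℚ) * φ.quantum)).toInt := by
  by_cases hrep : φ.Representable N.natAbs
  · rw [toInt_roundNE_of_representable hrep]; exact hN
  suffices h : 2 ^ g ∣ (roundNE φ ((N : ℚ) * φ.quantum)).scaledMag by
    rw [toInt_roundNE_intCast]
    split
    · exact dvd_neg.mpr (Int.natCast_dvd_natCast.mpr h)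
    · exact Int.natCast_dvd_natCast.mpr h
  have hv := pow_le_of_not_representable (Int.natCast_dvd.mp hN) hle hrep
  have hv' : 2 ^ φ.manBits * 2 ^ (g + 1) ≤ N.natAbs := by
    calc 2 ^ φ.manBits * 2 ^ (g + 1) = 2 ^ (φ.manBits + 1 + g) := by ring
      _ ≤ N.natAbs := hv
  have hvrep : φ.Representable (2 ^ φ.manBits * 2 ^ (g + 1)) :=
    representable_mul_pow (by rw [pow_succ]; have := Nat.two_pow_pos φ.manBits; omega)
      (le_trans hv' hle)
  have h1 := le_scaledMag_roundNE_of_representable_le hvrep hv'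
  have h2 := Format.pow_dvd_of_representable
    (roundNE φ ((N : ℚ) * φ.quantum)).representable_scaledMag (s := g + 1) (by rw [pow_add]; exact h1)
  exact dvd_trans (Nat.pow_dvd_pow 2 (Nat.le_succ g)) h2

/-- THE PRODUCT ERROR IS A VALUE OF THE FORMAT absent underflow and overflow: if
`(E_a - 1) + (E_b - 1) + qexp ≥ 0` (the product's grid `ulp(a)·ulp(b)` is not finer than the
quantum) and `|ab| ≤ maxRat`, then `ab - fl(ab) ∈ F_φ`. [cite: BoldoMelquiond2017, Lemma 5.9] -/
theorem mulErr_representable (a b : MiniFloat φ)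
    (hexp : 0 ≤ ((a.expCode - 1 : ℕ) : ℤ) + ((b.expCode - 1 : ℕ) : ℤ) + φ.qexp)
    (hr : |a.toRat * b.toRat| ≤ φ.maxRat) :
    ∃ e : MiniFloat φ, e.toRat = a.toRat * b.toRat - (roundNE φ (a.toRat * b.toRat)).toRat := by
  have hq := φ.quantum_pos
  -- the operands in quanta: |A| = 2^ja · ca, |B| = 2^jb · cb with ca, cb < 2^p
  obtain ⟨ca, hca⟩ := pow_ulpExp_dvd_scaledMag a
  obtain ⟨cb, hcb⟩ := pow_ulpExp_dvd_scaledMag b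
  set ja := a.expCode - 1 with hja
  set jb := b.expCode - 1 with hjb
  have hca_lt : ca < 2 ^ (φ.manBits + 1) := by
    have h := scaledMag_lt_pow_ulpExp a
    rw [hca, show φ.manBits + 1 + ja = ja + (φ.manBits + 1) by ring, pow_add] at h
    exact Nat.lt_of_mul_lt_mul_left h
  have hcb_lt : cb < 2 ^ (φ.manBits + 1) := by
    have h := scaledMag_lt_pow_ulpExp b
    rw [hcb, show φ.manBits + 1 + jb = jb + (φ.manBits + 1) by ring, pow_add] at h
    exact Nat.lt_of_mul_lt_mul_left h
  -- d := ja + jb + qexp ≥ 0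
  obtain ⟨d, hd⟩ : ∃ d : ℕ, ((ja : ℤ) + jb) + φ.qexp = d := ⟨_, (Int.toNat_of_nonneg (by linarith)).symm⟩
  -- the product in quanta: ab = N · q with N = ± ca cb 2^d
  set sgn : ℤ := (if a.neg then -1 else 1) * (if b.neg then -1 else 1) with hsgn
  have hsgn_abs : sgn = 1 ∨ sgn = -1 := by
    rw [hsgn]; cases a.neg <;> cases b.neg <;> simp
  set N : ℤ := sgn * ((ca * cb * 2 ^ d : ℕ) : ℤ) with hN
  have hA : (a.toInt : ℚ) = (if a.neg then -1 else 1) * ((2 ^ ja * ca : ℕ) : ℚ) := by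
    unfold toInt; rw [hca]; split <;> push_cast <;> ring
  have hB : (b.toInt : ℚ) = (if b.neg then -1 else 1) * ((2 ^ jb * cb : ℕ) : ℚ) := by
    unfold toInt; rw [hcb]; split <;> push_cast <;> ring
  have hpow : (2 : ℚ) ^ (ja + jb) * φ.quantum * φ.quantum = (2 : ℚ) ^ d * φ.quantum := by
    unfold Format.quantum
    rw [← zpow_natCast, ← zpow_natCast, ← zpow_add₀ (by norm_num), ← zpow_add₀ (by norm_num),
      ← zpow_add₀ (by norm_num)]
    congr 1; push_cast; linarith
  have hab : a.toRat * b.toRat = (N : ℚ) * φ.quantum := by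
    rw [toRat_eq_toInt_mul, toRat_eq_toInt_mul, hA, hB, hN, hsgn]
    push_cast
    have e : (2 : ℚ) ^ ja * ca * ((2 : ℚ) ^ jb * cb) * φ.quantum * φ.quantum
        = ca * cb * ((2 : ℚ) ^ (ja + jb) * φ.quantum * φ.quantum) := by rw [pow_add]; ring
    calc (if a.neg then -1 else 1 : ℚ) * (2 ^ ja * ca) * φ.quantum
          * ((if b.neg then -1 else 1 : ℚ) * (2 ^ jb * cb) * φ.quantum)
        = (if a.neg then -1 else 1 : ℚ) * (if b.neg then -1 else 1)
            * ((2 : ℚ) ^ ja * ca * ((2 : ℚ) ^ jb * cb) * φ.quantum * φ.quantum) := by ring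
      _ = (if a.neg then -1 else 1 : ℚ) * (if b.neg then -1 else 1) * (ca * cb * 2 ^ d) * φ.quantum := by
          rw [e, hpow]; ring
  -- facts about N
  have hNabs : N.natAbs = ca * cb * 2 ^ d := by
    rw [hN]; rcases hsgn_abs with h | h <;> rw [h] <;>
      simp [Int.natAbs_mul, Int.natAbs_pow, Int.natAbs_neg]
  have hNle : N.natAbs ≤ φ.maxScaled := by
    have h1 : |a.toRat * b.toRat| = (N.natAbs : ℚ) * φ.quantum := by
      rw [hab, abs_mul, abs_of_pos hq, Nat.cast_natAbs, Int.cast_abs]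
    rw [h1] at hr; unfold Format.maxRat at hr
    exact_mod_cast le_of_mul_le_mul_right hr hq
  have hNd : ((2 ^ d : ℕ) : ℤ) ∣ N := by
    apply Int.natCast_dvd.mpr; rw [hNabs]; exact Dvd.intro_left _ rfl
  have hNlt : N.natAbs < 2 ^ (2 * (φ.manBits + 1) + d) := by
    rw [hNabs, pow_add, show 2 * (φ.manBits + 1) = (φ.manBits + 1) + (φ.manBits + 1) by ring, pow_add]
    exact Nat.mul_lt_mul_of_pos_right (Nat.mul_lt_mul'' hca_lt hcb_lt) (Nat.two_pow_pos d)
  -- the rounded product and the error in quanta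
  set s := roundNE φ ((N : ℚ) * φ.quantum) with hs
  have hsab : roundNE φ (a.toRat * b.toRat) = s := by rw [hab]
  have hSd : ((2 ^ d : ℕ) : ℤ) ∣ s.toInt := pow_dvd_toInt_roundNE_of_le hNd hNle
  have hT : ((2 ^ d : ℕ) : ℤ) ∣ (N - s.toInt) := dvd_sub hNd hSd
  -- goal in quanta
  suffices hrepT : φ.Representable (N - s.toInt).natAbs by
    obtain ⟨e, he⟩ := exists_toRat_eq_intCast_mul _ hrepT
    exact ⟨e, by rw [he, hsab, hab, toRat_eq_toInt_mul s]; push_cast; ring⟩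
  by_cases hrepN : φ.Representable N.natAbs
  · -- exact product
    have : s.toInt = N := toInt_roundNE_of_representable hrepN
    rw [this, sub_self]; exact ⟨zero φ, rfl⟩
  · -- |N| ≥ 2^(p+d); binade exponent g with 2^(p+g) ≤ |N| < 2^(p+g+1), d ≤ g ≤ d + p - 1
    have hv := pow_le_of_not_representable (Int.natCast_dvd.mp hNd) hNle hrepN
    have hN0 : N.natAbs ≠ 0 := by
      intro h0; rw [h0] at hv; exact absurd hv (not_le.mpr (Nat.two_pow_pos _))
    set L := Nat.log 2 N.natAbs with hL
    have hL1 : 2 ^ L ≤ N.natAbs := Nat.pow_log_le_self 2 hN0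
    have hL2 : N.natAbs < 2 ^ (L + 1) := Nat.lt_pow_succ_log_self (by norm_num) _
    have hLge : φ.manBits + 1 + d ≤ L := by
      by_contra hlt
      have : 2 ^ (L + 1) ≤ 2 ^ (φ.manBits + 1 + d) := Nat.pow_le_pow_right (by norm_num) (by omega)
      omega
    have hLlt : L < 2 * (φ.manBits + 1) + d := by
      by_contra hge
      have : 2 ^ (2 * (φ.manBits + 1) + d) ≤ 2 ^ L := Nat.pow_le_pow_right (by norm_num) (by omega)
      omega
    obtain ⟨g, hg⟩ : ∃ g, L = φ.manBits + 1 + g := ⟨L - (φ.manBits + 1), by omega⟩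
    have hdg : d ≤ g := by omega
    have hgp : g ≤ d + φ.manBits := by omega
    have hhalf := natAbs_sub_scaledMag_roundNE_le (φ := φ) (g := g) (N := N)
      (by rw [← hg]; exact hL1) (by rw [show φ.manBits + 1 + (g + 1) = L + 1 by omega]; exact hL2) hNle
    rw [← hs] at hhalf
    have hsign : s.toInt = if N < 0 then -(s.scaledMag : ℤ) else (s.scaledMag : ℤ) := by
      rw [hs]; exact toInt_roundNE_intCast N
    -- |N - S| ≤ 2^g ≤ 2^(d+m) < 2^(m+1+d)
    have hZle : (N - s.toInt).natAbs ≤ 2 ^ g := by rw [hsign]; split <;> omega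
    have hpow_le : 2 ^ g ≤ 2 ^ (φ.manBits + d) := Nat.pow_le_pow_right (by norm_num) (by omega)
    refine representable_of_pow_dvd (Int.natCast_dvd.mp hT) ?_ ?_
    · calc (N - s.toInt).natAbs ≤ 2 ^ g := hZle
        _ ≤ 2 ^ (φ.manBits + d) := hpow_le
        _ ≤ 2 ^ (φ.manBits + 1 + d) := Nat.pow_le_pow_right (by norm_num) (by omega)
    · -- ≤ maxScaled: 2^g ≤ 2^L ≤ |N| ≤ maxScaled
      calc (N - s.toInt).natAbs ≤ 2 ^ g := hZle
        _ ≤ 2 ^ L := Nat.pow_le_pow_right (by norm_num) (by omega)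
        _ ≤ φ.maxScaled := le_trans hL1 hNle

/-- MAGNITUDE FORM of the no-underflow condition: `|ab| ≥ 2^(2p-1)·quantum` (`p = m+1`), together
with `|ab| ≤ maxRat`, implies that `ab - fl(ab)` is a value of `φ`.
[cite: BoldoMelquiond2017, Lemma 5.9] -/
theorem mulErr_representable_of_le (a b : MiniFloat φ)
    (hlo : (2 : ℚ) ^ (2 * φ.manBits + 1) * φ.quantum ≤ |a.toRat * b.toRat|)
    (hr : |a.toRat * b.toRat| ≤ φ.maxRat) :
    ∃ e : MiniFloat φ, e.toRat = a.toRat * b.toRat - (roundNE φ (a.toRat * b.toRat)).toRat := by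
  refine mulErr_representable a b ?_ hr
  have hq := φ.quantum_pos
  -- |ab| = |A||B| q² < 2^(p + ja) 2^(p + jb) q², so 2^(2p-1) q ≤ |ab| forces ja + jb + qexp ≥ 0
  have hA := scaledMag_lt_pow_ulpExp a
  have hB := scaledMag_lt_pow_ulpExp b
  have hab : |a.toRat * b.toRat| = (a.scaledMag : ℚ) * b.scaledMag * (φ.quantum * φ.quantum) := by
    rw [abs_mul, abs_toRat, abs_toRat]; ring
  have hlt : (a.scaledMag : ℚ) * b.scaledMag
      < (2 : ℚ) ^ (φ.manBits + 1 + (a.expCode - 1)) * (2 : ℚ) ^ (φ.manBits + 1 + (b.expCode - 1)) := by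
    have h1 : (a.scaledMag : ℚ) < (2 : ℚ) ^ (φ.manBits + 1 + (a.expCode - 1)) := by exact_mod_cast hA
    have h2 : (b.scaledMag : ℚ) < (2 : ℚ) ^ (φ.manBits + 1 + (b.expCode - 1)) := by exact_mod_cast hB
    have h0 : (0 : ℚ) ≤ a.scaledMag := by positivity
    have h0' : (0 : ℚ) ≤ b.scaledMag := by positivity
    calc (a.scaledMag : ℚ) * b.scaledMag
        ≤ (2 : ℚ) ^ (φ.manBits + 1 + (a.expCode - 1)) * b.scaledMag :=
          mul_le_mul_of_nonneg_right h1.le h0'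
      _ < (2 : ℚ) ^ (φ.manBits + 1 + (a.expCode - 1)) * (2 : ℚ) ^ (φ.manBits + 1 + (b.expCode - 1)) :=
          mul_lt_mul_of_pos_left h2 (by positivity)
  -- compare exponents: 2^(2m+1) q ≤ |ab| < 2^(2m+2 + ja + jb) q²  ⇒  0 < ja + jb + 1 + qexp
  have h2 : (2 : ℚ) ^ (2 * φ.manBits + 1) * φ.quantum
      < (2 : ℚ) ^ (φ.manBits + 1 + (a.expCode - 1)) * (2 : ℚ) ^ (φ.manBits + 1 + (b.expCode - 1))
        * (φ.quantum * φ.quantum) := by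
    rw [hab] at hlo
    exact lt_of_le_of_lt hlo (mul_lt_mul_of_pos_right hlt (by positivity))
  -- rewrite as powers of two with integer exponents
  unfold Format.quantum at h2
  have h3 : (2 : ℚ) ^ ((2 * φ.manBits + 1 : ℕ) + φ.qexp : ℤ)
      < (2 : ℚ) ^ (((φ.manBits + 1 + (a.expCode - 1) : ℕ) : ℤ) + ((φ.manBits + 1 + (b.expCode - 1) : ℕ) : ℤ)
        + φ.qexp + φ.qexp) := by
    rw [zpow_add₀ (by norm_num), zpow_natCast]
    rw [zpow_add₀ (by norm_num), zpow_add₀ (by norm_num), zpow_add₀ (by norm_num), zpow_natCast,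
      zpow_natCast]
    linarith
  have h4 := (zpow_lt_zpow_iff_right₀ (by norm_num : (1 : ℚ) < 2)).mp h3
  push_cast at h4
  omega

/-- `2MultFMA` IS EXACT under the same conditions: the fused `fl(ab - fl(ab))` (one rounding of the
exact residual) returns `ab - fl(ab)`. [cite: BoldoMelquiond2017, §5.2 (Algorithm 5.3)] -/
theorem twoMultFMA_exact (a b : MiniFloat φ)
    (hexp : 0 ≤ ((a.expCode - 1 : ℕ) : ℤ) + ((b.expCode - 1 : ℕ) : ℤ) + φ.qexp)
    (hr : |a.toRat * b.toRat| ≤ φ.maxRat) :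
    (roundNE φ (a.toRat * b.toRat - (roundNE φ (a.toRat * b.toRat)).toRat)).toRat
      = a.toRat * b.toRat - (roundNE φ (a.toRat * b.toRat)).toRat :=
  toRat_roundNE_of_exists (mulErr_representable a b hexp hr)

/-- BOTH SIDE CONDITIONS ARE NEEDED (kernel, `E2M1`, quantum `½`, `maxRat = 6`): `½ · ½ = ¼`
rounds to `0` (tie to even) with error `¼`, and `4 · 4 = 16` saturates to `6` with error `10`;
neither `¼` nor `10` is a value of `E2M1`. [folklore] -/
theorem mulErr_not_representable_examples :
    (roundNE Format.E2M1 ((1 : ℚ) / 2 * (1 / 2))).toRat = 0 ∧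
    (roundNE Format.E2M1 ((4 : ℚ) * 4)).toRat = 6 ∧
    (¬ ∃ e : MiniFloat Format.E2M1, e.toRat = 1 / 4) ∧
    (¬ ∃ e : MiniFloat Format.E2M1, e.toRat = 10) := by
  refine ⟨by decide +kernel, by decide +kernel, ?_, ?_⟩
  · rintro ⟨e, he⟩
    have h := quantum_le_abs_toRat e (by rw [he]; norm_num)
    rw [he, Format.E2M1_maxRat.2] at h
    norm_num at h
  · rintro ⟨e, he⟩
    have h := abs_toRat_le_maxRat e
    rw [he, Format.E2M1_maxRat.1] at h
    norm_num at h

end MiniFloat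

end Literature.ComputerArithmetic.FloatingPoint
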